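import Summits.QuantumFields.YangMills.Theorems.TwistedTraceScaling.Negative.WindowFloorGuards
import Summits.QuantumFields.YangMills.Theorems.LuscherReductionTwistedTraceScalingBaseWindow
import HarnessLib

/-!
# The window floor W(L) is a LEVEL-COUNTING statement: the profile quantifier `∃ g` is eliminable — crux disprover, cycle 61
# (route `LuscherReduction`, crux `TwistedTraceScaling` stmt-QuantumFields-20203, skeleton «twolattice» rev 3, stub S-BASE; `--supports`, helper only)

R72 (`…Negative.WindowFloorGuards`, `windowFloor_text_count`) recorded the forward direction: the window floor

  `W(L) : ∀ c₁ > 0, ∃ g ≥ 0 Laplace-summable, ∃ β₀, ∀ β ≥ β₀, ∀ k, λ_k(β,L) ≤ exp(−u(β)·min (g k) (c₁ log β))·λ₀(β,L)`   (`u = Λ(β,L)/L`)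

forces the sub-exponential LEVEL COUNT below the cap.  This file closes the loop:

  `COUNT(L) : ∀ c₁ > 0, ∃ β₀, ∀ t > 0, ∃ C, ∀ β ≥ β₀, ∀ E ∈ [0, c₁ log β], ∀ m, λ_m(β,L) > e^{−u(β)E}·λ₀(β,L) → m + 1 ≤ C·e^{tE}`

★ `windowFloor_text_iff_count : W(L) ↔ COUNT(L)`.  So the second-order-looking text W(L) (a `β`-UNIFORM summable profile `g`) is EXACTLY the
first-order statement "the number of lattice levels of femto energy `≤ E` is `≤ C_t e^{tE}` for every `t > 0`, uniformly in `β ≥ β₀` and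
`0 ≤ E ≤ c₁ log β`" — a capped, `β`-uniform, sub-exponential Weyl bound for the twisted transfer matrix at fixed `L`; nothing about WHICH levels,
no matching to reference levels, no profile to guess.  (Backward direction, `windowFloor_text_of_count`: the profile is the lower envelope
`g k = inf {e_β(k) : β ≥ β₀, e_β(k) < c₁ log β} ⊓ k` of the femto energies `e_β(k) = log(λ₀/λ_k)/u`; COUNT at `t/2` gives `k + 1 ≤ D_t e^{(t/2) g k}`,
whence `e^{−t g k} ≤ D_t²/(k+1)²`.)  The abstract core `profile_of_count` is stated for an arbitrary family of level energies.
Use: the lead may prove COUNT(L) (trial-state / bracketing counting, cf. R72 `windowFloor_caps_families`) instead of exhibiting `g`; conversely any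
mechanism producing `≳ e^{t₀E}` lattice levels below femto energy `E ≤ c₁ log β` for some fixed `t₀` (uniformly in `β`) KILLS W(L).
HONEST FRAMING: an equivalence for an OPEN hypothesis text (W(L)) of a stub (S-BASE) of a child of the CONDITIONAL reduction route R2b1 (femto
rung); COUNT(L) is OPEN; nothing here proves or refutes W(L) or the crux; not infinite volume, not a mass gap, not Clay.
-/

set_option autoImplicit false

noncomputable section

open MeasureTheory Filter Topology Real
open scoped BigOperators
open Literature.MathematicalPhysics.QuantumFieldTheory hiding SU2
open Literature.MathematicalPhysics.QuantumLattice
open Summit.QuantumFields.YangMills.Theorems.FemtoTransferGap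

namespace Summit.QuantumFields.YangMills.Theorems.TwistedTraceScaling.Negative.R74b

/-! ## §1 Abstract: femto energies, and a summable profile from a uniform sub-exponential count -/

/-- Window shape from a bound on the femto energy `log(x₀/x)/u`. [folklore] -/
theorem le_windowShape_of_le_logRatio {u x x0 m : ℝ} (hu : 0 < u) (hx : 0 < x) (hx0 : 0 < x0)
    (hm : m ≤ Real.log (x0 / x) / u) : x ≤ Real.exp (-(u * m)) * x0 := by
  have h1 : m * u ≤ Real.log (x0 / x) := (le_div_iff₀ hu).1 hm
  have h2 : x / x0 ≤ Real.exp (-(u * m)) := by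
    have h3 : Real.exp (-Real.log (x0 / x)) = x / x0 := by
      rw [Real.exp_neg, Real.exp_log (div_pos hx0 hx), inv_div]
    rw [← h3, Real.exp_le_exp]
    linarith
  calc x = x / x0 * x0 := by field_simp
    _ ≤ Real.exp (-(u * m)) * x0 := mul_le_mul_of_nonneg_right h2 hx0.le

/-- A level whose femto energy `log(x₀/x)/u` is `< E` lies above `e^{−uE}x₀`. [folklore] -/
theorem lt_of_logRatio_lt {u x x0 E : ℝ} (hu : 0 < u) (hx : 0 < x) (hx0 : 0 < x0)
    (hE : Real.log (x0 / x) / u < E) : Real.exp (-(u * E)) * x0 < x := by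
  have h1 : Real.log (x0 / x) < E * u := (div_lt_iff₀ hu).1 hE
  have h2 : Real.exp (-(u * E)) < x / x0 := by
    have h3 : Real.exp (-Real.log (x0 / x)) = x / x0 := by
      rw [Real.exp_neg, Real.exp_log (div_pos hx0 hx), inv_div]
    rw [← h3, Real.exp_lt_exp]
    linarith
  calc Real.exp (-(u * E)) * x0 < x / x0 * x0 := mul_lt_mul_of_pos_right h2 hx0
    _ = x := by field_simp

/-- ★ Abstract core.  A family of nonnegative "level energies" `e β k` (`β ≥ β₀`) whose counting functions below a cap are UNIFORMLY
sub-exponential — for every `t > 0` one constant `C` with `#{m : e β m < E} ≤ C e^{tE}` for all `β ≥ β₀`, `0 ≤ E ≤ cap β` — admits ONE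
Laplace-summable profile `g ≥ 0` with `g k ≤ e β k` whenever `e β k < cap β`.  (Profile: the lower envelope `inf {e β k} ⊓ k`; the count at `t/2`
gives `k + 1 ≤ D e^{(t/2) g k}`, so `e^{−t g k} ≤ (D/(k+1))²`.) [folklore] -/
theorem profile_of_count {e : ℝ → ℕ → ℝ} {β0 : ℝ} {cap : ℝ → ℝ}
    (he0 : ∀ β : ℝ, β0 ≤ β → ∀ k : ℕ, 0 ≤ e β k)
    (hcount : ∀ t : ℝ, 0 < t → ∃ C : ℝ, ∀ β : ℝ, β0 ≤ β → ∀ E : ℝ, 0 ≤ E → E ≤ cap β →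
      ∀ m : ℕ, e β m < E → (m : ℝ) + 1 ≤ C * Real.exp (t * E)) :
    ∃ g : ℕ → ℝ, (∀ k, 0 ≤ g k) ∧ (∀ t : ℝ, 0 < t → Summable fun k : ℕ => Real.exp (-t * g k)) ∧
      ∀ β : ℝ, β0 ≤ β → ∀ k : ℕ, e β k < cap β → g k ≤ e β k := by
  classical
  set S : ℕ → Set ℝ := fun k => insert (k : ℝ) {x : ℝ | ∃ β : ℝ, β0 ≤ β ∧ e β k < cap β ∧ x = e β k} with hS
  have hne : ∀ k, (S k).Nonempty := fun k => Set.insert_nonempty _ _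
  have hlow : ∀ k, ∀ y ∈ S k, 0 ≤ y := by
    intro k y hy
    rcases Set.mem_insert_iff.1 hy with rfl | ⟨β, hβ, -, rfl⟩
    · exact Nat.cast_nonneg k
    · exact he0 β hβ k
  have hbdd : ∀ k, BddBelow (S k) := fun k => ⟨0, fun y hy => hlow k y hy⟩
  refine ⟨fun k => sInf (S k), fun k => le_csInf (hne k) (hlow k), ?_, ?_⟩
  · intro t ht
    obtain ⟨C, hC⟩ := hcount (t / 2) (half_pos ht)
    set D : ℝ := 2 / t + 2 + max C 0 * Real.exp t with hD
    have hC0 : 0 ≤ max C 0 := le_max_right _ _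
    have ht2 : 0 < 2 / t := by positivity
    have hD1 : 2 / t + 2 ≤ D := by
      rw [hD]; have := mul_nonneg hC0 (Real.exp_pos t).le; linarith
    have hD2 : max C 0 * Real.exp t ≤ D := by rw [hD]; linarith
    -- pointwise: `k + 1 ≤ D e^{(t/2) g k}`
    have hkey : ∀ k : ℕ, (k : ℝ) + 1 ≤ D * Real.exp (t / 2 * sInf (S k)) := by
      intro k
      have hg0 : 0 ≤ sInf (S k) := le_csInf (hne k) (hlow k)
      obtain ⟨y, hy, hylt⟩ := exists_lt_of_csInf_lt (hne k) (lt_add_one (sInf (S k)))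
      have hpos : 0 < Real.exp (t / 2 * sInf (S k)) := Real.exp_pos _
      have hX : t / 2 * sInf (S k) + 1 ≤ Real.exp (t / 2 * sInf (S k)) := Real.add_one_le_exp _
      have h1 : 1 ≤ Real.exp (t / 2 * sInf (S k)) := by nlinarith [mul_nonneg (half_pos ht).le hg0]
      rcases Set.mem_insert_iff.1 hy with hyk | ⟨β, hβ, hcap, hye⟩
      · -- the envelope is within `1` of `k`
        rw [hyk] at hylt
        have hst : 2 / t * (t / 2) = 1 := by field_simp
        have hG : sInf (S k) ≤ 2 / t * (Real.exp (t / 2 * sInf (S k)) - 1) := by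
          have h6 : 2 / t * (t / 2 * sInf (S k)) ≤ 2 / t * (Real.exp (t / 2 * sInf (S k)) - 1) :=
            mul_le_mul_of_nonneg_left (by linarith) ht2.le
          calc sInf (S k) = 2 / t * (t / 2 * sInf (S k)) := by rw [← mul_assoc, hst, one_mul]
            _ ≤ _ := h6
        have h7 : (k : ℝ) + 1 ≤ (2 / t + 2) * Real.exp (t / 2 * sInf (S k)) := by
          have h8 : 2 / t * (Real.exp (t / 2 * sInf (S k)) - 1) ≤ 2 / t * Real.exp (t / 2 * sInf (S k)) := by
            apply mul_le_mul_of_nonneg_left _ ht2.le; linarith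
          have h9 : (2 / t + 2) * Real.exp (t / 2 * sInf (S k)) =
              2 / t * Real.exp (t / 2 * sInf (S k)) + 2 * Real.exp (t / 2 * sInf (S k)) := by ring
          rw [h9]; linarith
        exact h7.trans (mul_le_mul_of_nonneg_right hD1 hpos.le)
      · -- the envelope is within `1` of a sub-cap energy `e β k`: count at `E = min (e β k + 1) (cap β)`
        rw [hye] at hylt
        have he0' : 0 ≤ e β k := he0 β hβ k
        have hE0 : 0 ≤ min (e β k + 1) (cap β) := le_min (by linarith) (he0'.trans hcap.le)
        have hEcap : min (e β k + 1) (cap β) ≤ cap β := min_le_right _ _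
        have heE : e β k < min (e β k + 1) (cap β) := lt_min (lt_add_one _) hcap
        have hk := hC β hβ _ hE0 hEcap k heE
        have hE1 : min (e β k + 1) (cap β) ≤ e β k + 1 := min_le_left _ _
        have h8 : Real.exp (t / 2 * min (e β k + 1) (cap β)) ≤ Real.exp t * Real.exp (t / 2 * sInf (S k)) := by
          rw [← Real.exp_add, Real.exp_le_exp]
          have h9 : min (e β k + 1) (cap β) ≤ sInf (S k) + 2 := by linarith
          have h10 := mul_le_mul_of_nonneg_left h9 (half_pos ht).le
          have h11 : t / 2 * (sInf (S k) + 2) = t + t / 2 * sInf (S k) := by ring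
          linarith
        calc (k : ℝ) + 1 ≤ C * Real.exp (t / 2 * min (e β k + 1) (cap β)) := hk
          _ ≤ max C 0 * Real.exp (t / 2 * min (e β k + 1) (cap β)) :=
              mul_le_mul_of_nonneg_right (le_max_left _ _) (Real.exp_pos _).le
          _ ≤ max C 0 * (Real.exp t * Real.exp (t / 2 * sInf (S k))) := mul_le_mul_of_nonneg_left h8 hC0
          _ = (max C 0 * Real.exp t) * Real.exp (t / 2 * sInf (S k)) := by ring
          _ ≤ D * Real.exp (t / 2 * sInf (S k)) := mul_le_mul_of_nonneg_right hD2 hpos.le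
    -- summability by comparison with `(D/(k+1))²`
    have hs1 : Summable (fun n : ℕ => (((n + 1 : ℕ) : ℝ) ^ 2)⁻¹) :=
      (summable_nat_add_iff 1).2 (Real.summable_nat_pow_inv.2 (by norm_num))
    have hs2 : Summable (fun n : ℕ => (D / ((n : ℝ) + 1)) ^ 2) := by
      refine (hs1.mul_left (D ^ 2)).congr (fun n => ?_)
      rw [Nat.cast_succ, div_pow, div_eq_mul_inv]
    refine Summable.of_nonneg_of_le (fun k => (Real.exp_pos _).le) (fun k => ?_) hs2
    have hk1 : (0 : ℝ) < (k : ℝ) + 1 := by positivity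
    have hq : Real.exp (-(t / 2) * sInf (S k)) ≤ D / ((k : ℝ) + 1) := by
      rw [le_div_iff₀ hk1]
      have hmul : Real.exp (t / 2 * sInf (S k)) * Real.exp (-(t / 2) * sInf (S k)) = 1 := by
        rw [← Real.exp_add, show t / 2 * sInf (S k) + -(t / 2) * sInf (S k) = 0 by ring, Real.exp_zero]
      calc Real.exp (-(t / 2) * sInf (S k)) * ((k : ℝ) + 1)
          ≤ Real.exp (-(t / 2) * sInf (S k)) * (D * Real.exp (t / 2 * sInf (S k))) :=
            mul_le_mul_of_nonneg_left (hkey k) (Real.exp_pos _).le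
        _ = D * (Real.exp (t / 2 * sInf (S k)) * Real.exp (-(t / 2) * sInf (S k))) := by ring
        _ = D := by rw [hmul, mul_one]
    have hq0 : 0 ≤ Real.exp (-(t / 2) * sInf (S k)) := (Real.exp_pos _).le
    have hsq : Real.exp (-t * sInf (S k)) = Real.exp (-(t / 2) * sInf (S k)) * Real.exp (-(t / 2) * sInf (S k)) := by
      rw [← Real.exp_add]; congr 1; ring
    show Real.exp (-t * sInf (S k)) ≤ (D / ((k : ℝ) + 1)) ^ 2
    rw [hsq, sq]
    exact mul_le_mul hq hq hq0 (hq0.trans hq)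
  · intro β hβ k hk
    exact csInf_le (hbdd k) (Set.mem_insert_of_mem _ ⟨β, hβ, hk, rfl⟩)

/-! ## §2 ★ W(L) ⟺ COUNT(L) -/

section Levels

variable (L : ℕ) [NeZero L]

/-- ★ **W(L) from the capped, `β`-uniform, sub-exponential level count.**  If for every cap `c₁` there is ONE threshold `β₀` such that for
every `t > 0` some `C` bounds `m + 1 ≤ C e^{tE}` whenever `λ_m(β,L) > e^{−u(β)E}λ₀(β,L)`, `β ≥ β₀`, `0 ≤ E ≤ c₁ log β` (`u = Λ/L`), then W(L) holds
(verbatim `hW` of ✓`Base.fixedLatticeTraceLaw_of_upper_lower_window`, `L1 ↦ L`), with the profile `g k = inf_β e_β(k) ⊓ k`,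
`e_β(k) = log(λ₀/λ_k)/u(β)` the femto energy of the `k`-th level. [cite: ReedSimonIV1978, Thm. XIII.1] -/
theorem windowFloor_text_of_count
    (hcount : ∀ c₁ : ℝ, 0 < c₁ → ∃ β0 : ℝ, ∀ t : ℝ, 0 < t → ∃ C : ℝ, ∀ β : ℝ, β0 ≤ β → ∀ E : ℝ, 0 ≤ E → E ≤ c₁ * Real.log β →
      ∀ m : ℕ, Real.exp (-(luscherLambda β L / L * E)) * levelValue su2Rep L β 0 < levelValue su2Rep L β m →
        (m : ℝ) + 1 ≤ C * Real.exp (t * E)) :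
    ∀ c₁ : ℝ, 0 < c₁ → ∃ g : ℕ → ℝ, (∀ k, 0 ≤ g k) ∧
      (∀ t : ℝ, 0 < t → Summable fun k : ℕ => Real.exp (-t * g k)) ∧
      ∃ β0 : ℝ, ∀ β : ℝ, β0 ≤ β → ∀ k : ℕ,
        levelValue su2Rep L β k ≤
          Real.exp (-(luscherLambda β L / L * min (g k) (c₁ * Real.log β))) * levelValue su2Rep L β 0 := by
  intro c₁ hc₁
  obtain ⟨β0, hC⟩ := hcount c₁ hc₁
  obtain ⟨β1, h1⟩ := TwoLattice.Base.eventually_unit_le L one_pos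
  -- positivity package above `max β0 β1`
  have hpack : ∀ β : ℝ, max β0 β1 ≤ β → 0 < β ∧ 0 < luscherLambda β L / L := by
    intro β hβ
    obtain ⟨hβone, hu, -⟩ := h1 β (le_trans (le_max_right _ _) hβ)
    exact ⟨by linarith, hu⟩
  have he0 : ∀ β : ℝ, max β0 β1 ≤ β → ∀ k : ℕ,
      0 ≤ Real.log (levelValue su2Rep L β 0 / levelValue su2Rep L β k) / (luscherLambda β L / L) := by
    intro β hβ k
    obtain ⟨hβpos, hu⟩ := hpack β hβ
    have hlk : 0 < levelValue su2Rep L β k := levelValue_su2Rep_pos hβpos k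
    have hanti : levelValue su2Rep L β k ≤ levelValue su2Rep L β 0 :=
      KTRCalibration.levelValue_antitone hβpos.le (Nat.zero_le k)
    exact div_nonneg (Real.log_nonneg ((one_le_div hlk).2 hanti)) hu.le
  have hcnt : ∀ t : ℝ, 0 < t → ∃ C : ℝ, ∀ β : ℝ, max β0 β1 ≤ β → ∀ E : ℝ, 0 ≤ E → E ≤ c₁ * Real.log β →
      ∀ m : ℕ, Real.log (levelValue su2Rep L β 0 / levelValue su2Rep L β m) / (luscherLambda β L / L) < E →
        (m : ℝ) + 1 ≤ C * Real.exp (t * E) := by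
    intro t ht
    obtain ⟨C, hC'⟩ := hC t ht
    refine ⟨C, fun β hβ E hE0 hEcap m hm => hC' β (le_trans (le_max_left _ _) hβ) E hE0 hEcap m ?_⟩
    obtain ⟨hβpos, hu⟩ := hpack β hβ
    exact lt_of_logRatio_lt hu (levelValue_su2Rep_pos hβpos m) (levelValue_su2Rep_pos hβpos 0) hm
  obtain ⟨g, hg0, hgsum, hgle⟩ := profile_of_count
    (e := fun β k => Real.log (levelValue su2Rep L β 0 / levelValue su2Rep L β k) / (luscherLambda β L / L))
    (β0 := max β0 β1) (cap := fun β => c₁ * Real.log β) he0 hcnt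
  refine ⟨g, hg0, hgsum, max β0 β1, fun β hβ k => ?_⟩
  obtain ⟨hβpos, hu⟩ := hpack β hβ
  have hl0 : 0 < levelValue su2Rep L β 0 := levelValue_su2Rep_pos hβpos 0
  have hlk : 0 < levelValue su2Rep L β k := levelValue_su2Rep_pos hβpos k
  apply le_windowShape_of_le_logRatio hu hlk hl0
  by_cases hlt : Real.log (levelValue su2Rep L β 0 / levelValue su2Rep L β k) / (luscherLambda β L / L) < c₁ * Real.log β
  · exact (min_le_left _ _).trans (hgle β hβ k hlt)
  · exact (min_le_right _ _).trans (not_lt.1 hlt)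

/-- ★ **W(L) ⟺ COUNT(L)**: the window floor (a `β`-uniform Laplace-summable profile dominating the femto levels below the cap `c₁ log β`) is
EQUIVALENT to the capped, `β`-uniform, sub-exponential level count — the profile quantifier `∃ g` carries no information beyond counting.
(Forward: R72 `windowFloor_text_count` with `C = Σ'_k e^{−t g k}`; backward: `windowFloor_text_of_count`.) [cite: ReedSimonIV1978, Thm. XIII.1] -/
theorem windowFloor_text_iff_count :
    (∀ c₁ : ℝ, 0 < c₁ → ∃ g : ℕ → ℝ, (∀ k, 0 ≤ g k) ∧
      (∀ t : ℝ, 0 < t → Summable fun k : ℕ => Real.exp (-t * g k)) ∧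
      ∃ β0 : ℝ, ∀ β : ℝ, β0 ≤ β → ∀ k : ℕ,
        levelValue su2Rep L β k ≤
          Real.exp (-(luscherLambda β L / L * min (g k) (c₁ * Real.log β))) * levelValue su2Rep L β 0) ↔
    (∀ c₁ : ℝ, 0 < c₁ → ∃ β0 : ℝ, ∀ t : ℝ, 0 < t → ∃ C : ℝ, ∀ β : ℝ, β0 ≤ β → ∀ E : ℝ, 0 ≤ E → E ≤ c₁ * Real.log β →
      ∀ m : ℕ, Real.exp (-(luscherLambda β L / L * E)) * levelValue su2Rep L β 0 < levelValue su2Rep L β m →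
        (m : ℝ) + 1 ≤ C * Real.exp (t * E)) := by
  refine ⟨fun hW c₁ hc₁ => ?_, windowFloor_text_of_count L⟩
  obtain ⟨g, -, -, β0, h⟩ := R72.windowFloor_text_count hW c₁ hc₁
  obtain ⟨β1, h1⟩ := TwoLattice.Base.eventually_unit_le L one_pos
  have hL : (0 : ℝ) < L := by exact_mod_cast Nat.pos_of_ne_zero (NeZero.ne L)
  refine ⟨max β0 β1, fun t ht => ⟨∑' k, Real.exp (-t * g k), fun β hβ E _ hE m hm => ?_⟩⟩
  obtain ⟨hβone, hu, -⟩ := h1 β (le_trans (le_max_right _ _) hβ)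
  have hβpos : 0 < β := by linarith
  have hΛ : 0 < luscherLambda β L := by
    have := mul_pos hu hL
    rwa [div_mul_cancel₀ _ hL.ne'] at this
  exact (h β (le_trans (le_max_left _ _) hβ) hβpos hΛ E hE m hm t ht).trans_eq (mul_comm _ _)

end Levels

end Summit.QuantumFields.YangMills.Theorems.TwistedTraceScaling.Negative.R74b

end
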